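import Summits.MatrixMultiplication.OmegaCensus.STPPVosperSlackFourCell22Checker
import Summits.MatrixMultiplication.OmegaCensus.STPPVosperSlackTwoCheckersSound2

/-!
# ω-census (abelian STPP census): cell (2,2) of the slack-4 law — mask lemmas for the soundness of the checker (kernel tool)

HONEST FRAMING (pub-omega census; verbatim): lottery ticket; floor = certified bounds/negative ranges.
Census STRUCTURE (seat pub-omega-stpp-2 gen 28, 2026-08-29), family (b2).  Meaning lemmas for the primitives of `STPPVosperSlackFourCell22Checker.lean`
used by `STPPVosperSlackFourCell22Sound.lean`: bounds of disjunction folds, the "negative rotation" index arithmetic `mod_shift_neg`, the cast of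
`(p − d) % p`, the members of `dilRunsMask`, and the semantics of the prefix unions `c22Prefix` and of the forbidden-shift mask `c22Forb`.
UNCONDITIONAL; no `decide`.  Nothing here is progress on `ω`.

References: H. Cohn, R. Kleinberg, B. Szegedy, C. Umans, FOCS 2005 (arXiv:math/0511460), Def. 5.1 (the use); H. S. Warren, Hacker's Delight (2002), §2-1.
-/

namespace Summit.MatrixMultiplication.OmegaCensus.CubeNB.S2

open Summit.MatrixMultiplication.OmegaCensus.CubeNB.Bits

/-! ## Mask lemmas -/

/-- A disjunction fold of masks below `2^p` stays below `2^p`. [folklore] -/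
theorem foldl_lor_lt_two_pow {α : Type*} {p : ℕ} (f : α → ℕ) (hf : ∀ x, f x < 2 ^ p) : ∀ (l : List α) (a₀ : ℕ), a₀ < 2 ^ p →
    l.foldl (fun a x => a ||| f x) a₀ < 2 ^ p
  | [], a₀, h => h
  | x :: l, a₀, h => by rw [List.foldl_cons]; exact foldl_lor_lt_two_pow f hf l _ (Nat.or_lt_two_pow h (hf x))

/-- Rotating by the "negative" `(p − w % p) % p` reads bit `i + w`. [folklore] -/
theorem mod_shift_neg {p : ℕ} (hp : 0 < p) (i w : ℕ) : (i + p - (p - w % p) % p) % p = (i + w) % p := by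
  have hr : w % p < p := Nat.mod_lt _ hp
  rcases Nat.eq_zero_or_pos (w % p) with h0 | hpos
  · rw [h0, Nat.sub_zero, Nat.mod_self, Nat.sub_zero, Nat.add_mod_right, Nat.add_mod, h0, Nat.add_zero, Nat.mod_mod]
  · rw [Nat.mod_eq_of_lt (by omega : p - w % p < p), show i + p - (p - w % p) = i + w % p by omega, Nat.add_mod, Nat.mod_mod,
      ← Nat.add_mod]

/-- A mask whose set bits are all below `p` is below `2^p`. [folklore] -/
theorem lt_two_pow_of_tb {p M : ℕ} (h : ∀ v, tb M v = true → v < p) : M < 2 ^ p := by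
  refine Nat.lt_pow_two_of_testBit _ fun j hj => ?_
  rw [← tb_eq_testBit, Bool.eq_false_iff]
  intro htb
  have := h j htb; omega

/-- Meaning of `dilRunsMask`: bit `w` is set iff `w = u·(t + j) mod p` for a run `(t, m)` and `j < m`. [folklore] -/
theorem tb_dilRunsMask {p u w : ℕ} {rs : List (ℕ × ℕ)} : tb (dilRunsMask p u rs) w = true ↔ ∃ r ∈ rs, ∃ j < r.2, (u * (r.1 + j)) % p = w := by
  unfold dilRunsMask
  rw [tb_maskOf, List.mem_flatMap]
  constructor
  · rintro ⟨r, hr, hw⟩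
    obtain ⟨j, hj, rfl⟩ := List.mem_map.1 hw
    exact ⟨r, hr, j, List.mem_range.1 hj, rfl⟩
  · rintro ⟨r, hr, j, hj, rfl⟩
    exact ⟨r, hr, List.mem_map.2 ⟨j, List.mem_range.2 hj, rfl⟩⟩

/-- `dilRunsMask p u rs < 2^p` (for `0 < p`). [folklore] -/
theorem dilRunsMask_lt {p u : ℕ} (hp : 0 < p) (rs : List (ℕ × ℕ)) : dilRunsMask p u rs < 2 ^ p :=
  lt_two_pow_of_tb fun v hv => by obtain ⟨r, _, j, _, rfl⟩ := tb_dilRunsMask.1 hv; exact Nat.mod_lt _ hp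

/-- Every entry of the prefix-union list (and the default `0`) is below `2^p`. [folklore] -/
theorem c22Prefix_getD_lt (p u S n : ℕ) : (c22Prefix p u S).getD n 0 < 2 ^ p := by
  rw [List.getD_eq_getElem?_getD]
  cases h : (c22Prefix p u S)[n]? with
  | none => exact Nat.one_le_two_pow
  | some M =>
    have hM : M ∈ c22Prefix p u S := List.mem_of_getElem? h
    unfold c22Prefix at hM
    obtain ⟨m, _, rfl⟩ := List.mem_map.1 hM
    exact foldl_lor_lt_two_pow _ (fun j => rot_lt_two_pow p S _) _ 0 Nat.one_le_two_pow

/-- **Prefix-union semantics**: if bit `v < p` of entry `m ≤ 17` is set then `v + u·j ∈ S` for some `j < m`. [folklore] -/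
theorem tb_c22Prefix_getD {p u S m v : ℕ} (hp : 0 < p) (hS : S < 2 ^ p) (hm : m < 18) (hv : v < p)
    (h : tb ((c22Prefix p u S).getD m 0) v = true) : ∃ j < m, tb S ((v + u * j) % p) = true := by
  unfold c22Prefix at h
  rw [List.getD_eq_getElem?_getD, List.getElem?_map, List.getElem?_range hm, Option.map_some, Option.getD_some,
    tb_foldl_lor_fun] at h
  rcases h with h | ⟨j, hj, h⟩
  · rw [tb_eq_testBit, Nat.zero_testBit] at h; exact Bool.noConfusion h
  · refine ⟨j, List.mem_range.1 hj, ?_⟩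
    rwa [tb_rot hS (le_of_lt (Nat.mod_lt _ hp)) hv, mod_shift_neg hp] at h

/-- **Forbidden-shift semantics**: if bit `s < p` of `c22Forb p u Ms rs` is set then for some run `(t, m)` bit `s + u·t` of entry `m` is set.
[folklore] -/
theorem tb_c22Forb {p u s : ℕ} {Ms : List ℕ} {rs : List (ℕ × ℕ)} (hp : 0 < p) (hMs : ∀ n, Ms.getD n 0 < 2 ^ p) (hs : s < p)
    (h : tb (c22Forb p u Ms rs) s = true) : ∃ r ∈ rs, tb (Ms.getD r.2 0) ((s + u * r.1) % p) = true := by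
  unfold c22Forb at h
  rw [tb_foldl_lor_fun] at h
  rcases h with h | ⟨r, hr, h⟩
  · rw [tb_eq_testBit, Nat.zero_testBit] at h; exact Bool.noConfusion h
  · refine ⟨r, hr, ?_⟩
    rwa [tb_rot (hMs _) (le_of_lt (Nat.mod_lt _ hp)) hs, mod_shift_neg hp] at h

/-- `((p − d) % p : ℕ)` casts to `−d` in `ZMod p` (`d ≤ p`). [folklore] -/
theorem cast_negMod {p : ℕ} {d : ℕ} (hd : d ≤ p) : ((((p - d) % p : ℕ)) : ZMod p) = -(d : ZMod p) := by
  rw [ZMod.natCast_mod, Nat.cast_sub hd, ZMod.natCast_self, zero_sub]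


end Summit.MatrixMultiplication.OmegaCensus.CubeNB.S2
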